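import Summits.NavierStokesRegularity.NavierStokesRegularity.Theorems.SkeletonEquilibrium.Negative.ZeroAccretionSelectionReduced
import Summits.NavierStokesRegularity.NavierStokesRegularity.Theorems.FilamentSkeletonRssSkeletonEquilibriumBirthComposition

/-!
# The active stub set of crux `SkeletonEquilibrium` (stmt-NavierStokesRegularity-15400) is two-sided: kernel record

The item's registered stubs come from lines of BOTH signs: the birth / Sketch CONSTRUCTION lines
(`stub_equilibriumFamilyA1`, `stub_coreSymmA2` — existence of the C₄ skew-quartet equilibria) and the NEGATION lines
`kelvin-sonic-negation`, `mirror-point-negation`, `zero-accretion-selection` (`stub_lengthRegular`, …,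
`stub_strandSeparation`, `stub_zeroAccretionShadowing`). With the birth composition landed as a conditional tree theorem
(`Birth.skeletonEquilibrium_of_equilibriumFamilyA1`, p828392) and the hold hypothesis reduced to three conjuncts
(`Negative.SkeletonEquilibrium_false_of_three`, p828147), the incompatibility is one application:

* `equilibriumFamilyA1_false_of_three : LengthRegular → StrandSeparation → ZeroAccretionShadowing →
    ¬ (registered signature of stub_equilibriumFamilyA1)`;
* `equilibriumFamilyA1_false_of_zeroAccretionSelection : ZeroAccretionSelection → ¬ (same)` — the existence stub is
  FALSE modulo exactly the hypothesis modulo which the crux is held.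

HONEST LABEL: bookkeeping for a HELD support item (no stub is closed or refuted unconditionally; which side is true is the
open research content); no summit statement is proved; Navier–Stokes regularity is not touched.
-/

noncomputable section

-- `Summit.<Summit>.<Problem>`: single-conjunct summit, the duplicate segment is mandated (CONVENTIONS §2).
set_option linter.dupNamespace false

namespace Summit.NavierStokesRegularity.NavierStokesRegularity.Theorems.SkeletonEquilibrium.Negative

open Set MeasureTheory Filter Topology
open Literature.Analysis.FluidPDE

/-- **The birth existence stub is false modulo the three live negation conjuncts.** If all relative equilibria are
length-regular (`LengthRegular`), returning strands near waists are ball-locally chord–arc (`StrandSeparation`) and the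
zero-accretion shadowing package holds (`ZeroAccretionShadowing`), then the registered statement of
`stub_equilibriumFamilyA1` (C₄ skew quartet `N = 4`, `γ ≡ 16π`, `α = −1`, slips `C¹`-close to the certified model `W`)
fails: it would give the crux (`Birth.skeletonEquilibrium_of_equilibriumFamilyA1`), which the three conjuncts refute
(`SkeletonEquilibrium_false_of_three`). [folklore] -/
theorem equilibriumFamilyA1_false_of_three (hLR : LengthRegular) (hSS : StrandSeparation)
    (hZA : ZeroAccretionShadowing) :
    ¬ (∀ (W Wd : ℝ → ℝ),
        (∀ t, W t = t / 2 - 11 / 5 + 2400 / (272 * t ^ 2 - 320 * t + 425) + 2400 / (144 * t ^ 2 + 625)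
                          + 2400 / (272 * t ^ 2 + 320 * t + 425)) →
        (∀ t, Wd t = 1 / 2 - 2400 * (544 * t - 320) / (272 * t ^ 2 - 320 * t + 425) ^ 2
                          - 2400 * (288 * t) / (144 * t ^ 2 + 625) ^ 2
                          - 2400 * (544 * t + 320) / (272 * t ^ 2 + 320 * t + 425) ^ 2) →
        ∀ ε : ℝ, 0 < ε → ∃ ρ K : ℝ, 0 < ρ ∧ ∀ Γ₀ : ℝ, ∃ Γ : ℝ, Γ₀ ≤ Γ ∧ 0 < Γ ∧
          ∃ (Ξ : Fin 4 → ℝ → EuclideanSpace ℝ (Fin 3)) (w : Fin 4 → ℝ → ℝ),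
            (∀ j, ContDiff ℝ 2 (Ξ j) ∧ Function.Injective (Ξ j) ∧ Differentiable ℝ (w j) ∧
                (∀ τ, ‖deriv (Ξ j) τ‖ = 1) ∧ (∀ τ, ‖iteratedDeriv 2 (Ξ j) τ‖ * Real.sqrt Γ ≤ K) ∧
                Tendsto (fun τ => ‖Ξ j τ‖) atTop atTop ∧ Tendsto (fun τ => ‖Ξ j τ‖) atBot atTop) ∧
            (∀ j k, j ≠ k → ∀ τ σ, ρ * Real.sqrt Γ ≤ ‖Ξ j τ - Ξ k σ‖) ∧
            (∀ j (x : EuclideanSpace ℝ (Fin 3)), Integrable (fun σ : ℝ =>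
                ((‖x - Ξ j σ‖ ^ 2 + 1) ^ (3 / 2 : ℝ))⁻¹ • cross (deriv (Ξ j) σ) (x - Ξ j σ))) ∧
            (∀ j τ, (∑ k : Fin 4, (Γ * (16 * Real.pi) / (4 * Real.pi)) • ∫ σ : ℝ,
                  ((‖Ξ j τ - Ξ k σ‖ ^ 2 + 1) ^ (3 / 2 : ℝ))⁻¹ • cross (deriv (Ξ k) σ) (Ξ j τ - Ξ k σ))
                + (1 / 2 : ℝ) • Ξ j τ - (-1 : ℝ) • cross (EuclideanSpace.single (2 : Fin 3) (1 : ℝ)) (Ξ j τ)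
                = w j τ • deriv (Ξ j) τ) ∧
            (∀ j t, |t| ≤ 10 →
                |w j (Real.sqrt Γ * t) / Real.sqrt Γ - W t| ≤ ε ∧ |deriv (w j) (Real.sqrt Γ * t) - Wd t| ≤ ε) ∧
            (∀ j t, 10 ≤ |t| → w j (Real.sqrt Γ * t) ≠ 0)) :=
  fun hA1 => SkeletonEquilibrium_false_of_three hLR hSS hZA (Birth.skeletonEquilibrium_of_equilibriumFamilyA1 hA1)

/-- The same, from the hold hypothesis `ZeroAccretionSelection` itself. [folklore] -/
theorem equilibriumFamilyA1_false_of_zeroAccretionSelection (h : ZeroAccretionSelection) :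
    ¬ (∀ (W Wd : ℝ → ℝ),
        (∀ t, W t = t / 2 - 11 / 5 + 2400 / (272 * t ^ 2 - 320 * t + 425) + 2400 / (144 * t ^ 2 + 625)
                          + 2400 / (272 * t ^ 2 + 320 * t + 425)) →
        (∀ t, Wd t = 1 / 2 - 2400 * (544 * t - 320) / (272 * t ^ 2 - 320 * t + 425) ^ 2
                          - 2400 * (288 * t) / (144 * t ^ 2 + 625) ^ 2
                          - 2400 * (544 * t + 320) / (272 * t ^ 2 + 320 * t + 425) ^ 2) →
        ∀ ε : ℝ, 0 < ε → ∃ ρ K : ℝ, 0 < ρ ∧ ∀ Γ₀ : ℝ, ∃ Γ : ℝ, Γ₀ ≤ Γ ∧ 0 < Γ ∧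
          ∃ (Ξ : Fin 4 → ℝ → EuclideanSpace ℝ (Fin 3)) (w : Fin 4 → ℝ → ℝ),
            (∀ j, ContDiff ℝ 2 (Ξ j) ∧ Function.Injective (Ξ j) ∧ Differentiable ℝ (w j) ∧
                (∀ τ, ‖deriv (Ξ j) τ‖ = 1) ∧ (∀ τ, ‖iteratedDeriv 2 (Ξ j) τ‖ * Real.sqrt Γ ≤ K) ∧
                Tendsto (fun τ => ‖Ξ j τ‖) atTop atTop ∧ Tendsto (fun τ => ‖Ξ j τ‖) atBot atTop) ∧
            (∀ j k, j ≠ k → ∀ τ σ, ρ * Real.sqrt Γ ≤ ‖Ξ j τ - Ξ k σ‖) ∧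
            (∀ j (x : EuclideanSpace ℝ (Fin 3)), Integrable (fun σ : ℝ =>
                ((‖x - Ξ j σ‖ ^ 2 + 1) ^ (3 / 2 : ℝ))⁻¹ • cross (deriv (Ξ j) σ) (x - Ξ j σ))) ∧
            (∀ j τ, (∑ k : Fin 4, (Γ * (16 * Real.pi) / (4 * Real.pi)) • ∫ σ : ℝ,
                  ((‖Ξ j τ - Ξ k σ‖ ^ 2 + 1) ^ (3 / 2 : ℝ))⁻¹ • cross (deriv (Ξ k) σ) (Ξ j τ - Ξ k σ))
                + (1 / 2 : ℝ) • Ξ j τ - (-1 : ℝ) • cross (EuclideanSpace.single (2 : Fin 3) (1 : ℝ)) (Ξ j τ)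
                = w j τ • deriv (Ξ j) τ) ∧
            (∀ j t, |t| ≤ 10 →
                |w j (Real.sqrt Γ * t) / Real.sqrt Γ - W t| ≤ ε ∧ |deriv (w j) (Real.sqrt Γ * t) - Wd t| ≤ ε) ∧
            (∀ j t, 10 ≤ |t| → w j (Real.sqrt Γ * t) ≠ 0)) :=
  fun hA1 => SkeletonEquilibrium_false_of_ZeroAccretionSelection h (Birth.skeletonEquilibrium_of_equilibriumFamilyA1 hA1)

end Summit.NavierStokesRegularity.NavierStokesRegularity.Theorems.SkeletonEquilibrium.Negative

end
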